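/- EXTRA WIDTH seat `ym-line-cbag-p1-w4` (prover-ym-line-cbag-p1-w4-g13-0), LINE 7b `VolumeComparison` of route `GlueballBandRecursion`,
item ⟨stmt-QuantumFields-22957⟩ (`--supports`, helper; it closes nothing).  CLOSEDNESS BY SUPPORT, the Möbius/branch half: the
Kotecký–Preiss logarithm of a regular plaquette system regrouped by the SUPPORT of its clusters, the vanishing of whole support
classes from a factorisation of the partition function (free bond) or from disconnectedness, and the closedness-aware truncation
with the rate-tracking tail.  Generic in the plaquette system (`S : PlaqSystem d G ι` on `zdHaar d G`); def-free. -/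
import Literature.MathematicalPhysics.QuantumFieldTheory.PlaqSystemLogZAnalytic
import Literature.MathematicalPhysics.QuantumFieldTheory.PeriodicBoxRooting
import Literature.Probability.LatticeModels.PolymerPressure

/-!
# Route `GlueballBandRecursion`, LINE 7b (volume comparison of the cold trace excess): the cluster expansion of `log Z`
# regrouped by support — Möbius form, vanishing of non-closed and of disconnected supports, truncation by support

For a regular plaquette system `S : PlaqSystem d G ι` (`StrongCouplingPolymerSystem`) on the Haar product `ν = zdHaar d G`
write `log Z(W)(z) = pertLogZ ν (S.weight z) S.Adj W` for the Kotecký–Preiss logarithm of `S.partZ W z` (`PlaqSystemClusterExpansion`)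
and `Φ^T(𝒞)` for the truncated functional of a finite family `𝒞` of polymers (`S.Adj`-connected label sets).  The tree's cluster
expansion `log Z(W) = Σ_{𝒞 ⊆ 𝒫(W)} Φ^T(𝒞)` (`pertLogZ_eq_sum_truncatedWeight`) is a FINITE sum; we regroup it by the support
`A = ⋃ 𝒞 ⊆ W`:

* §1–§2 `pertLogZ_eq_sum_support`: `log Z(W) = Σ_{A ⊆ W} ψ(A)` with the SUPPORT SUM
  `ψ(A) := Σ_{𝒞 ⊆ 𝒫(A), ⋃𝒞 = A} Φ^T(𝒞)` (written out; no definition is introduced), and `support_sum_eq_moebius`: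
  `ψ(A) = Σ_{B ⊆ A} (−1)^{#(A∖B)} log Z(B)` (Boolean Möbius inversion) — `ψ` is the label-set analogue of `Φ^T`.
* §3 `support_sum_eq_zero_of_partZ_eq_mul` (**free-bond vanishing, abstract form**): if `p ∈ A`, `2 ≤ #A`, and the partition
  function FACTORISES, `S.partZ B = S.partZ {p} · S.partZ (B.erase p)` on the strong-coupling disc for every `p ∈ B ⊆ A` (for the
  Wilson box system this is Haar averaging over a bond of `p` private in `A` — the width seat w3's `FreeBondAveraging`), then
  `ψ(A) = 0` on the disc: `log Z(B) = log Z{p} + log Z(B.erase p)` as the SAME continuous branch (`exp log Z = Z`, continuity on the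
  disc, value `0` at `z = 0`), and the Möbius sum of a function of `B ∩ {p}` plus a function of `B ∩ (A.erase p)` vanishes.
* §4 `support_sum_eq_zero_of_not_isRConnected`: `ψ(A) = 0` for disconnected `A ≠ ∅` (a family of connected polymers with
  disconnected union is no cluster, and `Φ^T` vanishes off clusters in a KP volume), `support_sum_empty`, `support_sum_singleton`.
* (sequel `…SupportTruncation.lean`) the closedness-aware truncation `‖log Z(W) − Σ_{kept A} ψ(A)‖ ≤ #W · e^{−τ m}` with the
  tree's rate-tracking tail.

Use (LINE 7b, LEAD ym-line-cbag-p1 g29 / w2 g23 remark R2): with `S = boxSystem ρ ![N,N,N,t]`, `P A` = «closed, connected, all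
spatial extents ≤ N − 2», §3 + free-bond averaging kill the non-closed classes, the slab count gives `m = 4(N−1)` for the wide
closed connected ones, and the kept sum is `N³ ×` an `N`-independent rooted sum — the closedness-aware jet/volume comparison of the
thermal free-energy density with NO cumulant and NO Taylor coefficient computed.

HONEST FRAMING.  Finite combinatorics and one branch argument on top of the tree's Kotecký–Preiss layer; nothing here proves the
volume comparison, item 22957, the RECORD rung `ColdDoublingRecursionStrongCoupling`, or the Yang–Mills mass gap / the summit `YangMills`.
-/

set_option autoImplicit false

noncomputable section

open MeasureTheory Finset Filter Topology
open Literature.Probability.LatticeModels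
open Literature.MathematicalPhysics.QuantumFieldTheory

namespace Summit.QuantumFields.YangMills.Theorems.GlueballBandRecursion.Support

/-! ## §1 Boolean Möbius inversion (converse direction) -/

/-- **Möbius inversion on the Boolean lattice, converse**: if `f(B) = Σ_{A' ⊆ B} g(A')` for all `B ⊆ A`, then
`g(A) = Σ_{B ⊆ A} (−1)^{#(A∖B)} f(B)`. -/
theorem eq_moebius_of_forall_eq_sum_powerset {α : Type*} [DecidableEq α] {R : Type*} [CommRing R]
    (f g : Finset α → R) (A : Finset α) (h : ∀ B ⊆ A, f B = ∑ A' ∈ B.powerset, g A') :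
    g A = ∑ B ∈ A.powerset, (-1 : R) ^ (A \ B).card * f B := by
  induction A using Finset.strongInduction with
  | H A ih =>
    -- `f A = Σ_{C ⊆ A} μf(C)` (tree Möbius) and `f A = Σ_{A' ⊆ A} g A'`; the proper parts agree by induction
    have hμ := sum_powerset_sum_powerset_neg_one_pow_card_sdiff_mul f A
    have hA : A ∈ A.powerset := Finset.mem_powerset.2 Finset.Subset.rfl
    have hg := h A Finset.Subset.rfl
    rw [← Finset.add_sum_erase _ _ hA] at hμ hg
    have hrest : ∑ C ∈ A.powerset.erase A, ∑ B ∈ C.powerset, (-1 : R) ^ (C \ B).card * f B =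
        ∑ C ∈ A.powerset.erase A, g C := by
      refine Finset.sum_congr rfl fun C hC => ?_
      obtain ⟨hCA, hCsub⟩ := Finset.mem_erase.1 hC
      have hss : C ⊂ A := lt_of_le_of_ne (Finset.mem_powerset.1 hCsub) hCA
      exact (ih C hss fun B hB => h B (hB.trans hss.le)).symm
    rw [hrest] at hμ
    exact (add_right_cancel (hμ.trans hg)).symm

/-- The fibre of the support map over `A ⊆ W` inside the families of polymers of `W` is the fibre inside the families of polymers
of `A`. -/
theorem filter_powerset_rconnSubsets_biUnion_eq {ι : Type*} [DecidableEq ι] (R : ι → ι → Prop) [DecidableRel R]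
    {W A : Finset ι} (hAW : A ⊆ W) :
    ((rconnSubsets R W).powerset.filter fun 𝒞 => 𝒞.biUnion id = A) =
      ((rconnSubsets R A).powerset.filter fun 𝒞 => 𝒞.biUnion id = A) := by
  ext 𝒞
  simp only [Finset.mem_filter, Finset.mem_powerset]
  constructor
  · rintro ⟨h𝒞, hsup⟩
    refine ⟨fun X hX => ?_, hsup⟩
    have hXW := mem_rconnSubsets.1 (h𝒞 hX)
    refine mem_rconnSubsets.2 ⟨?_, hXW.2⟩
    rw [← hsup]
    exact Finset.subset_biUnion_of_mem id hX
  · rintro ⟨h𝒞, hsup⟩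
    refine ⟨fun X hX => ?_, hsup⟩
    have hXA := mem_rconnSubsets.1 (h𝒞 hX)
    exact mem_rconnSubsets.2 ⟨hXA.1.trans hAW, hXA.2⟩

/-! ## §2 The cluster expansion regrouped by support -/

section Support

variable {d : ℕ} {G : Type*} [Group G] [TopologicalSpace G] [IsTopologicalGroup G] [CompactSpace G]
  [MeasurableSpace G] [BorelSpace G] {ι : Type*} [DecidableEq ι] {S : PlaqSystem d G ι} {M : ℝ} {D : ℕ}

variable (S) in
/-- **The cluster expansion of `log Z` regrouped by support**: for every finite label set `W` and every complex coupling `z`,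
`log Z(W)(z) = Σ_{A ⊆ W} ψ(A)(z)` with `ψ(A) = Σ_{𝒞 ⊆ 𝒫(A), ⋃ 𝒞 = A} Φ^T(𝒞)` (an identity of finite sums, no smallness needed). -/
theorem pertLogZ_eq_sum_support (W : Finset ι) (z : ℂ) :
    pertLogZ (zdHaar d G) (S.weight z) S.Adj W =
      ∑ A ∈ W.powerset, ∑ 𝒞 ∈ (rconnSubsets S.Adj A).powerset with 𝒞.biUnion id = A,
        truncatedWeight (GeomInc S.Adj) (connActivity S.Adj (zdHaar d G) (S.weight z)) 𝒞 := by
  rw [pertLogZ_eq_sum_truncatedWeight]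
  set Φ : Finset (Finset ι) → ℂ :=
    truncatedWeight (GeomInc S.Adj) (connActivity S.Adj (zdHaar d G) (S.weight z)) with hΦ
  have hmaps : ∀ 𝒞 ∈ (rconnSubsets S.Adj W).powerset, 𝒞.biUnion id ∈ W.powerset := by
    intro 𝒞 h𝒞
    refine Finset.mem_powerset.2 (Finset.biUnion_subset.2 fun X hX => ?_)
    exact (mem_rconnSubsets.1 (Finset.mem_powerset.1 h𝒞 hX)).1
  have h1 := Finset.sum_fiberwise_of_maps_to (f := Φ) hmaps
  rw [← h1]
  refine Finset.sum_congr rfl fun A hA => ?_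
  have h2 := filter_powerset_rconnSubsets_biUnion_eq S.Adj (Finset.mem_powerset.1 hA)
  rw [h2]

variable (S) in
/-- **Möbius form of the support sum**: `ψ(A)(z) = Σ_{B ⊆ A} (−1)^{#(A∖B)} log Z(B)(z)` — the support sum is the Möbius transform,
on the lattice of label subsets, of the Kotecký–Preiss logarithm (the label-level twin of `truncatedWeight`). -/
theorem support_sum_eq_moebius (A : Finset ι) (z : ℂ) :
    ∑ 𝒞 ∈ (rconnSubsets S.Adj A).powerset with 𝒞.biUnion id = A,
        truncatedWeight (GeomInc S.Adj) (connActivity S.Adj (zdHaar d G) (S.weight z)) 𝒞 =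
      ∑ B ∈ A.powerset, (-1 : ℂ) ^ (A \ B).card * pertLogZ (zdHaar d G) (S.weight z) S.Adj B := by
  refine eq_moebius_of_forall_eq_sum_powerset (fun B => pertLogZ (zdHaar d G) (S.weight z) S.Adj B)
    (fun A' => ∑ 𝒞 ∈ (rconnSubsets S.Adj A').powerset with 𝒞.biUnion id = A',
      truncatedWeight (GeomInc S.Adj) (connActivity S.Adj (zdHaar d G) (S.weight z)) 𝒞) A ?_
  intro B _
  exact pertLogZ_eq_sum_support S B z

/-- The support sum of the empty set vanishes (`Φ^T(∅) = 0`). -/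
theorem support_sum_empty (z : ℂ) :
    ∑ 𝒞 ∈ (rconnSubsets S.Adj (∅ : Finset ι)).powerset with 𝒞.biUnion id = ∅,
        truncatedWeight (GeomInc S.Adj) (connActivity S.Adj (zdHaar d G) (S.weight z)) 𝒞 = 0 := by
  have h0 : rconnSubsets S.Adj (∅ : Finset ι) = ∅ := by
    ext X
    simp only [mem_rconnSubsets, Finset.subset_empty, Finset.notMem_empty, iff_false, not_and]
    rintro rfl h
    exact Finset.not_nonempty_empty h.1
  rw [h0, Finset.powerset_empty, Finset.sum_filter, Finset.sum_singleton, Finset.biUnion_empty, if_pos rfl,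
    truncatedWeight_empty]

/-- The support sum of a singleton is the logarithm of the one-label partition function: `ψ({p}) = log Z({p})`. -/
theorem support_sum_singleton (p : ι) (z : ℂ) :
    ∑ 𝒞 ∈ (rconnSubsets S.Adj ({p} : Finset ι)).powerset with 𝒞.biUnion id = {p},
        truncatedWeight (GeomInc S.Adj) (connActivity S.Adj (zdHaar d G) (S.weight z)) 𝒞 =
      pertLogZ (zdHaar d G) (S.weight z) S.Adj {p} := by
  rw [pertLogZ_eq_sum_support S {p} z, ← LawfulSingleton.insert_empty_eq,
    Finset.sum_powerset_insert (Finset.notMem_empty p), Finset.powerset_empty, Finset.sum_singleton,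
    Finset.sum_singleton, support_sum_empty, zero_add]

/-! ## §3 Vanishing of a support class from a factorisation of the partition function (free bond) -/

/-- The Kotecký–Preiss logarithm vanishes when all activities do. -/
theorem polymerLogZ_eq_zero_of_forall_eq_zero {P : Type*} [DecidableEq P] {inc : P → P → Prop} [DecidableRel inc]
    [Std.Symm inc] {w : P → ℂ} (Λ : Finset P) (h : ∀ γ ∈ Λ, w γ = 0) : polymerLogZ inc w Λ = 0 := by
  induction Λ using Finset.induction_on with
  | empty => exact polymerLogZ_empty w
  | insert a s ha ih =>
    rw [polymerLogZ_eq_erase_of_eq_zero (h a (Finset.mem_insert_self a s)), Finset.erase_insert ha]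
    exact ih fun γ hγ => h γ (Finset.mem_insert_of_mem hγ)

/-- At zero coupling every weight `f_p^0 = e^0 − 1` vanishes, hence so does `log Z(W)(0)`. -/
theorem pertLogZ_weight_zero (W : Finset ι) : pertLogZ (zdHaar d G) (S.weight 0) S.Adj W = 0 := by
  unfold pertLogZ
  refine polymerLogZ_eq_zero_of_forall_eq_zero _ fun X hX => ?_
  obtain ⟨-, hXne, -⟩ := mem_rconnSubsets.1 hX
  obtain ⟨p, hp⟩ := hXne
  have hw : S.weight 0 p = fun _ => 0 := by funext U; simp [PlaqSystem.weight]
  unfold connActivity cellActivity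
  split_ifs
  · rw [MeasureTheory.integral_eq_zero_of_ae (Filter.Eventually.of_forall fun U => ?_)]
    exact Finset.prod_eq_zero hp (by rw [hw])
  · rfl

/-- The empty label set has `log Z(∅) = 0`. -/
theorem pertLogZ_empty_labels (z : ℂ) : pertLogZ (zdHaar d G) (S.weight z) S.Adj (∅ : Finset ι) = 0 := by
  have h0 : rconnSubsets S.Adj (∅ : Finset ι) = ∅ := by
    ext X
    simp only [mem_rconnSubsets, Finset.subset_empty, Finset.notMem_empty, iff_false, not_and]
    rintro rfl h
    exact Finset.not_nonempty_empty h.1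
  unfold pertLogZ
  rw [h0, polymerLogZ_empty]

/-- **A continuous function with `exp φ = 1` on a disc and `φ(0) = 0` vanishes on the disc** (its norm has preconnected image inside
`2π·ℕ` containing `0`). -/
theorem eq_zero_of_cexp_eq_one {r : ℝ} {φ : ℂ → ℂ} (hφ : ContinuousOn φ (Metric.closedBall 0 r))
    (hexp : ∀ z ∈ Metric.closedBall (0 : ℂ) r, Complex.exp (φ z) = 1) (h0 : φ 0 = 0)
    {z : ℂ} (hz : z ∈ Metric.closedBall (0 : ℂ) r) : φ z = 0 := by
  have hr : 0 ≤ r := by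
    have := hz; rw [Metric.mem_closedBall, dist_zero_right] at this; exact (norm_nonneg _).trans this
  have h0K : (0 : ℂ) ∈ Metric.closedBall (0 : ℂ) r := Metric.mem_closedBall_self hr
  -- the norm has a preconnected image
  have hpre : IsPreconnected ((fun w => ‖φ w‖) '' Metric.closedBall (0 : ℂ) r) :=
    ((convex_closedBall (0 : ℂ) r).isPreconnected).image _ (continuous_norm.comp_continuousOn hφ)
  -- every value is `2π |n|`
  have hval : ∀ w ∈ Metric.closedBall (0 : ℂ) r, ∃ n : ℤ, ‖φ w‖ = 2 * Real.pi * |(n : ℝ)| := by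
    intro w hw
    obtain ⟨n, hn⟩ := Complex.exp_eq_one_iff.1 (hexp w hw)
    refine ⟨n, ?_⟩
    rw [hn]
    simp only [norm_mul, Complex.norm_intCast, Complex.norm_I, mul_one, Complex.norm_ofNat, Complex.norm_real,
      Real.norm_eq_abs, abs_of_pos Real.pi_pos]
    ring
  obtain ⟨n, hn⟩ := hval z hz
  by_cases hn0 : n = 0
  · rw [hn0] at hn
    simpa using hn
  · exfalso
    -- `π` lies between `‖φ 0‖ = 0` and `‖φ z‖ ≥ 2π`, hence is a value `2π|m|`: absurd
    have h1 : (1 : ℝ) ≤ |(n : ℝ)| := by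
      rw [← Int.cast_abs]; exact_mod_cast Int.one_le_abs hn0
    have hπmem : Real.pi ∈ Set.Icc ‖φ 0‖ ‖φ z‖ := by
      rw [h0, norm_zero, hn]
      exact ⟨Real.pi_pos.le, by nlinarith [Real.pi_pos]⟩
    have hsub := hpre.Icc_subset (Set.mem_image_of_mem _ h0K) (Set.mem_image_of_mem _ hz) hπmem
    obtain ⟨w, hw, hwπ⟩ := hsub
    obtain ⟨m, hm⟩ := hval w hw
    have hmπ : 2 * |(m : ℝ)| = 1 := by
      have : (2 * |(m : ℝ)|) * Real.pi = 1 * Real.pi := by rw [one_mul]; simp only at hwπ; linarith [hm, hwπ]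
      exact mul_right_cancel₀ Real.pi_pos.ne' this
    have hint : (2 * |m| : ℤ) = 1 := by exact_mod_cast hmπ
    omega

omit [Group G] [TopologicalSpace G] [IsTopologicalGroup G] [CompactSpace G] [BorelSpace G] [DecidableEq ι] in
/-- From `‖z‖ ≤ r` and the disc hypotheses at radius `r` to the disc hypotheses at `z`. -/
theorem disc_of_norm_le (hR : S.Regular M D) {r : ℝ} (hrM : r * M ≤ 1)
    (hsmall : Real.exp 1 * (2 * M * r) * ((D : ℝ) + 1) ^ 2 ≤ 1 / 2) {z : ℂ} (hz : ‖z‖ ≤ r) :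
    ‖z‖ * M ≤ 1 ∧ Real.exp 1 * (2 * M * ‖z‖) * ((D : ℝ) + 1) ^ 2 ≤ 1 / 2 := by
  have hM := hR.pos
  exact ⟨le_trans (by gcongr) hrM, le_trans (by gcongr) hsmall⟩

/-- **Additivity of the Kotecký–Preiss logarithm from a factorisation of the partition function.**  If
`S.partZ B = S.partZ {p} · S.partZ (B.erase p)` on the closed disc `‖z‖ ≤ r` (disc hypotheses `rM ≤ 1`, `e(2Mr)(D+1)² ≤ 1/2`), then
`log Z(B) = log Z({p}) + log Z(B.erase p)` there — both sides are continuous logarithms of the same function on the (connected)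
disc and agree at `z = 0`. -/
theorem pertLogZ_eq_add_of_partZ_eq_mul (hR : S.Regular M D) {r : ℝ} (hrM : r * M ≤ 1)
    (hsmall : Real.exp 1 * (2 * M * r) * ((D : ℝ) + 1) ^ 2 ≤ 1 / 2) (B : Finset ι) (p : ι)
    (hfac : ∀ z : ℂ, ‖z‖ ≤ r → S.partZ B z = S.partZ {p} z * S.partZ (B.erase p) z) {z : ℂ} (hz : ‖z‖ ≤ r) :
    pertLogZ (zdHaar d G) (S.weight z) S.Adj B =
      pertLogZ (zdHaar d G) (S.weight z) S.Adj {p} + pertLogZ (zdHaar d G) (S.weight z) S.Adj (B.erase p) := by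
  set φ : ℂ → ℂ := fun w => pertLogZ (zdHaar d G) (S.weight w) S.Adj B -
    (pertLogZ (zdHaar d G) (S.weight w) S.Adj {p} + pertLogZ (zdHaar d G) (S.weight w) S.Adj (B.erase p)) with hφ
  have hcont : ContinuousOn φ (Metric.closedBall 0 r) :=
    (PlaqSystem.continuousOn_pertLogZ hR hrM hsmall B).sub
      ((PlaqSystem.continuousOn_pertLogZ hR hrM hsmall {p}).add
        (PlaqSystem.continuousOn_pertLogZ hR hrM hsmall (B.erase p)))
  have hexp : ∀ w ∈ Metric.closedBall (0 : ℂ) r, Complex.exp (φ w) = 1 := by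
    intro w hw
    rw [Metric.mem_closedBall, dist_zero_right] at hw
    obtain ⟨hwM, hwsmall⟩ := disc_of_norm_le hR hrM hsmall hw
    simp only [hφ, Complex.exp_sub, Complex.exp_add, PlaqSystem.exp_pertLogZ_eq_partZ hR hwM hwsmall]
    rw [hfac w hw, div_self]
    exact mul_ne_zero (PlaqSystem.partZ_ne_zero_of_small hR hwM hwsmall _)
      (PlaqSystem.partZ_ne_zero_of_small hR hwM hwsmall _)
  have h0 : φ 0 = 0 := by simp only [hφ, pertLogZ_weight_zero, add_zero, sub_zero]
  have hzK : z ∈ Metric.closedBall (0 : ℂ) r := by rwa [Metric.mem_closedBall, dist_zero_right]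
  have := eq_zero_of_cexp_eq_one hcont hexp h0 hzK
  simp only [hφ] at this
  exact sub_eq_zero.1 this

/-- **Free-bond vanishing of a support class (abstract form).**  Let `p ∈ A`, `2 ≤ #A`, and suppose the partition function
factorises off `p` inside `A`: `S.partZ B = S.partZ {p} · S.partZ (B.erase p)` on the disc `‖z‖ ≤ r` for every `B` with `p ∈ B ⊆ A` (for
the Wilson box system: `p` has a bond private in `A`, and Haar averaging over it).  Then the support sum of `A` vanishes on the disc:
`ψ(A)(z) = Σ_{𝒞 ⊆ 𝒫(A), ⋃𝒞 = A} Φ^T(𝒞) = 0` — NON-CLOSED SUPPORTS DROP OUT OF THE EXPANSION AS WHOLE CLASSES. -/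
theorem support_sum_eq_zero_of_partZ_eq_mul (hR : S.Regular M D) {r : ℝ} (hrM : r * M ≤ 1)
    (hsmall : Real.exp 1 * (2 * M * r) * ((D : ℝ) + 1) ^ 2 ≤ 1 / 2) {A : Finset ι} {p : ι} (hpA : p ∈ A)
    (hA : 2 ≤ A.card)
    (hfac : ∀ B ⊆ A, p ∈ B → ∀ z : ℂ, ‖z‖ ≤ r → S.partZ B z = S.partZ {p} z * S.partZ (B.erase p) z)
    {z : ℂ} (hz : ‖z‖ ≤ r) :
    ∑ 𝒞 ∈ (rconnSubsets S.Adj A).powerset with 𝒞.biUnion id = A,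
        truncatedWeight (GeomInc S.Adj) (connActivity S.Adj (zdHaar d G) (S.weight z)) 𝒞 = 0 := by
  rw [support_sum_eq_moebius]
  set f : Finset ι → ℂ := pertLogZ (zdHaar d G) (S.weight z) S.Adj with hf
  -- additivity on every `B ⊆ A`, written with intersections
  have hadd : ∀ B ∈ A.powerset, f B = f (B ∩ {p}) + f (B ∩ A.erase p) := by
    intro B hB
    have hBA : B ⊆ A := Finset.mem_powerset.1 hB
    by_cases hpB : p ∈ B
    · have h1 : B ∩ {p} = {p} := Finset.inter_singleton_of_mem hpB
      have h2 : B ∩ A.erase p = B.erase p := by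
        ext q
        simp only [Finset.mem_inter, Finset.mem_erase]
        constructor
        · rintro ⟨hq, hqp, -⟩; exact ⟨hqp, hq⟩
        · rintro ⟨hqp, hq⟩; exact ⟨hq, hqp, hBA hq⟩
      rw [h1, h2]
      exact pertLogZ_eq_add_of_partZ_eq_mul hR hrM hsmall B p (hfac B hBA hpB) hz
    · have h1 : B ∩ {p} = ∅ := Finset.inter_singleton_of_notMem hpB
      have h2 : B ∩ A.erase p = B := by
        ext q
        simp only [Finset.mem_inter, Finset.mem_erase, and_iff_left_iff_imp]
        exact fun hq => ⟨fun h => hpB (h ▸ hq), hBA hq⟩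
      rw [h1, h2, hf]
      simp only [pertLogZ_empty_labels, zero_add]
  rw [Finset.sum_congr rfl fun B hB => by rw [hadd B hB]]
  simp only [mul_add, Finset.sum_add_distrib]
  have hp1 : ({p} : Finset ι) ⊆ A := Finset.singleton_subset_iff.2 hpA
  have hne1 : (A \ {p}).Nonempty := by
    rw [← Finset.card_pos, Finset.card_sdiff_of_subset hp1, Finset.card_singleton]
    omega
  have hne2 : (A \ A.erase p).Nonempty :=
    ⟨p, Finset.mem_sdiff.2 ⟨hpA, Finset.notMem_erase p A⟩⟩
  rw [sum_powerset_neg_one_pow_mul_apply_inter_eq_zero f hp1 hne1,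
    sum_powerset_neg_one_pow_mul_apply_inter_eq_zero f (Finset.erase_subset p A) hne2, add_zero]

/-! ## §4 Disconnected supports vanish -/

/-- From the rate-`τ` smallness (`τ ≥ 0`) to the Dobrushin smallness `e ε (D+1)² ≤ 1/2`. -/
theorem smallness_one_of_rate {ε τ : ℝ} (hε : 0 ≤ ε) (hτ : 0 ≤ τ)
    (h : Real.exp (1 + τ) * ε * ((D : ℝ) + 1) ^ 2 ≤ 1 / 2) :
    Real.exp 1 * ε * ((D : ℝ) + 1) ^ 2 ≤ 1 / 2 := by
  have h1 : Real.exp 1 ≤ Real.exp (1 + τ) := Real.exp_le_exp.2 (by linarith)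
  have h2 : 0 ≤ ε * ((D : ℝ) + 1) ^ 2 := by positivity
  nlinarith

/-- **Disconnected supports vanish.**  On the Dobrushin disc `‖z‖M ≤ 1`, `e(2M‖z‖)(D+1)² ≤ 1/2`, the support sum of a nonempty label set
which is not `S.Adj`-connected is zero: a family of connected polymers with union `A` would be a cluster with disconnected support
(`isRConnected_biUnion_of_isPolymerCluster`), and `Φ^T` vanishes off clusters in a KP volume. -/
theorem support_sum_eq_zero_of_not_isRConnected (hR : S.Regular M D) {z : ℂ} (hzM : ‖z‖ * M ≤ 1)
    (hsmall : Real.exp 1 * (2 * M * ‖z‖) * ((D : ℝ) + 1) ^ 2 ≤ 1 / 2) {A : Finset ι} (hA : A.Nonempty)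
    (hconn : ¬ IsRConnected S.Adj A) :
    ∑ 𝒞 ∈ (rconnSubsets S.Adj A).powerset with 𝒞.biUnion id = A,
        truncatedWeight (GeomInc S.Adj) (connActivity S.Adj (zdHaar d G) (S.weight z)) 𝒞 = 0 := by
  refine Finset.sum_eq_zero fun 𝒞 h𝒞 => ?_
  obtain ⟨h𝒞sub, hsup⟩ := Finset.mem_filter.1 h𝒞
  have h𝒞sub' : 𝒞 ⊆ rconnSubsets S.Adj A := Finset.mem_powerset.1 h𝒞sub
  have hne : 𝒞.Nonempty := by
    rw [Finset.nonempty_iff_ne_empty]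
    rintro rfl
    rw [Finset.biUnion_empty] at hsup
    exact hA.ne_empty hsup.symm
  have hncl : ¬ IsPolymerCluster (GeomInc S.Adj) 𝒞 := by
    intro hcl
    have h := isRConnected_biUnion_of_isPolymerCluster hcl (fun Y hY => (mem_rconnSubsets.1 (h𝒞sub' hY)).2) hne
    rw [hsup] at h
    exact hconn h
  have hKP := isKPVolume_connActivity (R := S.Adj) hR.card_near_le (fun x y h => S.mem_near x y h)
    (PlaqSystem.isLocalPerturbation hR hzM) hsmall (rconnSubsets S.Adj A)
  exact truncatedWeight_eq_zero_of_kp hKP h𝒞sub' hncl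

end Support

end Summit.QuantumFields.YangMills.Theorems.GlueballBandRecursion.Support

end
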